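import Literature.MathematicalPhysics.QuantumManyBody.BoseGasFreeDirichletBEC

/-!
# Negative lemmas for crux `PeriodicToDirichlet` (stmt-AtomisticToContinuum-9483), rewarded free gas III:
plateau modes of the unit cube

Supports (does not close) stmt-AtomisticToContinuum-9483 (crux `PeriodicToDirichlet`, route
`BECThomsonPrinciple`), line `reward-pays-the-wall`, stub `Unrewarding` (skeleton
`Cruxes/PeriodicToDirichlet/Lines/reward-pays-the-wall.lean`, not an importable module: its
reward vocabulary is copied verbatim in part II). Filed by the crux disprover (gen 3). Series:
I `RewardedFreeGasSlab` (translation/slab/one-body flat overlap) and III `RewardedFreeGasPlateau`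
(plateau modes) are independent; II `RewardedFreeGasCap` (flat mode, `N`-body bound, the cap
`flatCap < 1` at `λ = 0`, reward vocabulary) imports I; IV `RewardedFreeGasAnchors` (rewarded
anchors for every `c < 1` at `v = 0`; `¬ UnrewardingSameConstant`) imports II and III.

This part (all `[folklore]`, sorry-free): `energy_zero_lt_top` (every Dirichlet trial state has
finite kinetic energy); the plateau `plateau hη hη4 = ∏ₖ h(xₖ)` (`h = bump1`, a `ContDiffBump`
equal to `1` on `[2η, 1−2η]`, supported in `(η, 1−η)`), its mass `(1−4η)³ ≤ ∫g² ≤ 1`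
(`le_plateauMass`, `plateauMass_le_one`, `volume_innerCube`), the normalised mode
`plateauMode = g/‖g‖` (`lintegral_plateauMode_sq`, `contDiff_plateauMode`, `plateauMode_eq_zero`)
and its almost full flat content `|∫ u|² ≥ (1−4η)⁶` (`integral_plateauMode_sq_ge`).
-/

noncomputable section

open MeasureTheory Filter Set Metric
open scoped ENNReal NNReal ComplexConjugate Topology

namespace Summit.AtomisticToContinuum.BoseEinsteinCondensation.Theorems.PeriodicToDirichlet.Negative

open Literature.MathematicalPhysics.QuantumManyBody.BoseGas

/-! ## §5 Plateau states: at `v = 0` the rewarded anchors hold for EVERY `c < 1` (no `A` needed) -/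

/-- The free (kinetic) energy of every Dirichlet trial state is finite (`C¹` with compact
support). [folklore] -/
theorem energy_zero_lt_top {N : ℕ} {L : ℝ} (Ψ : TrialState N L) : energy 0 Ψ < ⊤ := by
  have hψc := Ψ.contDiff
  have hψs : HasCompactSupport Ψ.ψ :=
    HasCompactSupport.intro (isCompact_closedBall (0 : Config N) (3 * |L|)) fun X hX =>
      Ψ.eq_zero X fun hb => hX (boxN_subset_closedBall N L hb)
  have hkin : ∀ (i : Fin N) (k : Fin 3),
      (∫⁻ X, (‖fderiv ℝ Ψ.ψ X (Pi.single i (EuclideanSpace.single k (1 : ℝ)))‖₊ : ℝ≥0∞) ^ 2)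
        < ⊤ := by
    intro i k
    set e : Config N := Pi.single i (EuclideanSpace.single k (1 : ℝ))
    have hg : Continuous fun X => fderiv ℝ Ψ.ψ X e :=
      (hψc.continuous_fderiv one_ne_zero).clm_apply continuous_const
    have hgs : HasCompactSupport fun X => fderiv ℝ Ψ.ψ X e := hψs.fderiv_apply (𝕜 := ℝ) _
    have hgs2 : HasCompactSupport fun X => ‖fderiv ℝ Ψ.ψ X e‖ ^ 2 :=
      hgs.mono fun X hX h0 => hX (by simp [h0])
    have hint2 : Integrable (fun X => ‖fderiv ℝ Ψ.ψ X e‖ ^ 2) volume :=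
      (hg.norm.pow 2).integrable_of_hasCompactSupport hgs2
    have := hint2.lintegral_lt_top
    refine lt_of_le_of_lt (le_of_eq (lintegral_congr fun X => ?_)) this
    rw [ENNReal.ofReal_pow (norm_nonneg _), ofReal_norm]
    rfl
  change (∫⁻ X, kineticDensity Ψ.ψ X + interaction 0 X * (‖Ψ.ψ X‖₊ : ℝ≥0∞) ^ 2) < ⊤
  simp_rw [interaction_zeroPotential, zero_mul, add_zero, kineticDensity]
  rw [lintegral_finsetSum _ fun i _ => Finset.measurable_sum _ fun j _ =>
    ((measurable_fderiv_apply_const ℝ Ψ.ψ _).nnnorm.coe_nnreal_ennreal).pow_const 2]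
  refine ENNReal.sum_lt_top.2 fun i _ => ?_
  rw [lintegral_finsetSum _ fun j _ =>
    ((measurable_fderiv_apply_const ℝ Ψ.ψ _).nnnorm.coe_nnreal_ennreal).pow_const 2]
  exact ENNReal.sum_lt_top.2 fun j _ => hkin i j

section Plateau

variable {η : ℝ}

/-- The one-dimensional plateau: a smooth bump centred at `1/2`, equal to `1` on `[2η, 1 − 2η]`
and supported in `(η, 1 − η)`. [folklore] -/
def bump1 (hη : 0 < η) (hη4 : η < 1 / 4) : ContDiffBump ((1 : ℝ) / 2) :=
  ⟨1 / 2 - 2 * η, 1 / 2 - η, by linarith, by linarith⟩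

/-- The three-dimensional plateau profile `g(x) = ∏ₖ h(xₖ)` on the unit cube. [folklore] -/
def plateau (hη : 0 < η) (hη4 : η < 1 / 4) (x : Space) : ℝ :=
  ∏ k : Fin 3, bump1 hη hη4 (x k)

variable (hη : 0 < η) (hη4 : η < 1 / 4)

/-- `0 ≤ g`. [folklore] -/
theorem plateau_nonneg (x : Space) : 0 ≤ plateau hη hη4 x :=
  Finset.prod_nonneg fun _ _ => (bump1 hη hη4).nonneg

/-- `g ≤ 1`. [folklore] -/
theorem plateau_le_one (x : Space) : plateau hη hη4 x ≤ 1 :=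
  Finset.prod_le_one (fun _ _ => (bump1 hη hη4).nonneg) fun _ _ => (bump1 hη hη4).le_one

/-- `g = 1` on the inner cube `[2η, 1 − 2η]³`. [folklore] -/
theorem plateau_eq_one {x : Space} (hx : ∀ k, x k ∈ Icc (2 * η) (1 - 2 * η)) :
    plateau hη hη4 x = 1 := by
  refine Finset.prod_eq_one fun k _ => (bump1 hη hη4).one_of_mem_closedBall ?_
  rw [mem_closedBall, Real.dist_eq, abs_le]
  have := hx k
  simp only [mem_Icc] at this
  constructor <;> simp only [bump1] <;> linarith

/-- `g = 0` off the open unit cube. [folklore] -/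
theorem plateau_eq_zero {x : Space} (hx : x ∉ box 1) : plateau hη hη4 x = 0 := by
  have hx' : ¬ ∀ k, x k ∈ Ioo (0 : ℝ) 1 := hx
  obtain ⟨k, hk⟩ := not_forall.1 hx'
  refine Finset.prod_eq_zero (Finset.mem_univ k) ((bump1 hη hη4).zero_of_le_dist ?_)
  rw [Real.dist_eq]
  simp only [bump1, mem_Ioo, not_and_or, not_lt] at hk ⊢
  rcases hk with hk | hk
  · rw [abs_of_nonpos (by linarith)]; linarith
  · rw [abs_of_nonneg (by linarith)]; linarith

/-- `g` is `C¹` (indeed smooth). [folklore] -/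
theorem contDiff_plateau : ContDiff ℝ 1 (plateau hη hη4) :=
  contDiff_prod fun k _ => (bump1 hη hη4).contDiff.comp (EuclideanSpace.proj (𝕜 := ℝ) k).contDiff

/-- `g` is continuous. [folklore] -/
theorem continuous_plateau : Continuous (plateau hη hη4) := (contDiff_plateau hη hη4).continuous

/-- The inner cube as a preimage of a product of intervals. [folklore] -/
theorem innerCube_eq_preimage (η : ℝ) :
    {x : Space | ∀ k, x k ∈ Icc (2 * η) (1 - 2 * η)} =
      (@WithLp.ofLp 2 (Fin 3 → ℝ)) ⁻¹' (Set.univ.pi fun _ => Icc (2 * η) (1 - 2 * η)) := by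
  ext x
  simp only [Set.mem_setOf_eq, Set.mem_preimage, Set.mem_univ_pi]

/-- The inner cube is measurable. [folklore] -/
theorem measurableSet_innerCube (η : ℝ) :
    MeasurableSet {x : Space | ∀ k, x k ∈ Icc (2 * η) (1 - 2 * η)} := by
  rw [innerCube_eq_preimage]
  exact (MeasurableSet.univ_pi fun _ => measurableSet_Icc).preimage
    (PiLp.continuous_ofLp 2 _).measurable

/-- The inner cube has volume `(1 − 4η)³`. [folklore] -/
theorem volume_innerCube :
    volume {x : Space | ∀ k, x k ∈ Icc (2 * η) (1 - 2 * η)} = ENNReal.ofReal (1 - 4 * η) ^ 3 := by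
  rw [innerCube_eq_preimage, (PiLp.volume_preserving_ofLp (Fin 3)).measure_preimage
    (MeasurableSet.univ_pi fun _ => measurableSet_Icc).nullMeasurableSet, volume_pi_pi]
  simp only [Real.volume_Icc, Finset.prod_const, Finset.card_univ, Fintype.card_fin]
  congr 2; ring

/-- The mass `∫ g²` of the plateau. [folklore] -/
def plateauMass : ℝ≥0∞ := ∫⁻ x, (‖(plateau hη hη4 x : ℂ)‖₊ : ℝ≥0∞) ^ 2

/-- `g²` pointwise in `ℝ≥0∞`. [folklore] -/
theorem ennnorm_plateau_sq (x : Space) :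
    (‖(plateau hη hη4 x : ℂ)‖₊ : ℝ≥0∞) ^ 2 = ENNReal.ofReal (plateau hη hη4 x ^ 2) := by
  rw [← Poincare.ofReal_norm_sq, Complex.norm_real, Real.norm_of_nonneg (plateau_nonneg hη hη4 x)]

/-- `∫ g² ≤ |Λ₁| = 1`. [folklore] -/
theorem plateauMass_le_one : plateauMass hη hη4 ≤ 1 := by
  unfold plateauMass
  calc ∫⁻ x, (‖(plateau hη hη4 x : ℂ)‖₊ : ℝ≥0∞) ^ 2
      ≤ ∫⁻ x, (box 1).indicator (fun _ => (1 : ℝ≥0∞)) x := by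
        refine lintegral_mono fun x => ?_
        by_cases hx : x ∈ box 1
        · rw [Set.indicator_of_mem hx, ennnorm_plateau_sq, ← ENNReal.ofReal_one]
          refine ENNReal.ofReal_le_ofReal ?_
          have h0 := plateau_nonneg hη hη4 x
          have h1 := plateau_le_one hη hη4 x
          nlinarith
        · rw [Set.indicator_of_notMem hx, plateau_eq_zero hη hη4 hx]; simp
    _ = 1 := by
        rw [lintegral_indicator (measurableSet_box 1), setLIntegral_const, volume_box]; simp

/-- `(1 − 4η)³ ≤ ∫ g²`. [folklore] -/
theorem le_plateauMass : ENNReal.ofReal (1 - 4 * η) ^ 3 ≤ plateauMass hη hη4 := by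
  rw [← volume_innerCube (η := η), ← setLIntegral_one]
  unfold plateauMass
  calc ∫⁻ _ in {x : Space | ∀ k, x k ∈ Icc (2 * η) (1 - 2 * η)}, (1 : ℝ≥0∞)
      ≤ ∫⁻ x in {x : Space | ∀ k, x k ∈ Icc (2 * η) (1 - 2 * η)},
          (‖(plateau hη hη4 x : ℂ)‖₊ : ℝ≥0∞) ^ 2 := by
        refine setLIntegral_mono' (measurableSet_innerCube η) fun x hx => ?_
        rw [plateau_eq_one hη hη4 hx]; simp
    _ ≤ _ := setLIntegral_le_lintegral _ _

/-- The mass is positive … [folklore] -/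
theorem plateauMass_ne_zero : plateauMass hη hη4 ≠ 0 := by
  have h : (0 : ℝ≥0∞) < ENNReal.ofReal (1 - 4 * η) ^ 3 :=
    ENNReal.pow_pos (by rw [ENNReal.ofReal_pos]; linarith) 3
  exact (h.trans_le (le_plateauMass hη hη4)).ne'

/-- … and finite. [folklore] -/
theorem plateauMass_ne_top : plateauMass hη hη4 ≠ ⊤ :=
  ne_top_of_le_ne_top ENNReal.one_ne_top (plateauMass_le_one hη hη4)

/-- The normalising constant `‖g‖⁻¹`. [folklore] -/
def plateauConst : ℝ≥0 := NNReal.sqrt ((plateauMass hη hη4).toNNReal)⁻¹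

/-- `‖g‖⁻² · ∫g² = 1`. [folklore] -/
theorem plateauConst_sq_mul : (plateauConst hη hη4 : ℝ≥0∞) ^ 2 * plateauMass hη hη4 = 1 := by
  rw [plateauConst, ← ENNReal.coe_pow, NNReal.sq_sqrt,
    ENNReal.coe_inv (ENNReal.toNNReal_ne_zero.2 ⟨plateauMass_ne_zero hη hη4, plateauMass_ne_top hη hη4⟩),
    ENNReal.coe_toNNReal (plateauMass_ne_top hη hη4),
    ENNReal.inv_mul_cancel (plateauMass_ne_zero hη hη4) (plateauMass_ne_top hη hη4)]

/-- `‖g‖⁻² ≥ 1` (since `∫ g² ≤ 1`). [folklore] -/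
theorem one_le_plateauConst_sq : (1 : ℝ≥0∞) ≤ (plateauConst hη hη4 : ℝ≥0∞) ^ 2 := by
  calc (1 : ℝ≥0∞) = (plateauConst hη hη4 : ℝ≥0∞) ^ 2 * plateauMass hη hη4 :=
        (plateauConst_sq_mul hη hη4).symm
    _ ≤ (plateauConst hη hη4 : ℝ≥0∞) ^ 2 * 1 := by gcongr; exact plateauMass_le_one hη hη4
    _ = _ := mul_one _

/-- **The plateau mode** `u = g/‖g‖` (normalised, `C¹`, supported in the unit cube).
[folklore] -/
def plateauMode (x : Space) : ℂ := (plateauConst hη hη4 : ℂ) * (plateau hη hη4 x : ℂ)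

/-- `|u|² = ‖g‖⁻² g²`. [folklore] -/
theorem ennnorm_plateauMode_sq (x : Space) :
    (‖plateauMode hη hη4 x‖₊ : ℝ≥0∞) ^ 2 =
      (plateauConst hη hη4 : ℝ≥0∞) ^ 2 * (‖(plateau hη hη4 x : ℂ)‖₊ : ℝ≥0∞) ^ 2 := by
  rw [plateauMode, nnnorm_mul, ENNReal.coe_mul, mul_pow]
  congr 2
  simp

/-- `u` is normalised. [folklore] -/
theorem lintegral_plateauMode_sq : ∫⁻ x, (‖plateauMode hη hη4 x‖₊ : ℝ≥0∞) ^ 2 = 1 := by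
  simp_rw [ennnorm_plateauMode_sq]
  rw [lintegral_const_mul' _ _ (ENNReal.pow_ne_top ENNReal.coe_ne_top)]
  exact plateauConst_sq_mul hη hη4

/-- `u` vanishes off the unit cube. [folklore] -/
theorem plateauMode_eq_zero {x : Space} (hx : x ∉ box 1) : plateauMode hη hη4 x = 0 := by
  simp [plateauMode, plateau_eq_zero hη hη4 hx]

/-- `u` is `C¹`. [folklore] -/
theorem contDiff_plateauMode : ContDiff ℝ 1 (plateauMode hη hη4) :=
  contDiff_const.mul (Complex.ofRealCLM.contDiff.comp (contDiff_plateau hη hη4))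

/-- `u` as a one-particle wave function is `C¹`. [folklore] -/
theorem contDiff_oneFun_plateauMode : ContDiff ℝ 1 (oneFun (plateauMode hη hη4)) :=
  (contDiff_plateauMode hη hη4).comp (contDiff_apply ℝ Space 0)

/-- `u` as a one-particle wave function is normalised. [folklore] -/
theorem lintegral_oneFun_plateauMode_sq :
    ∫⁻ Y, (‖oneFun (plateauMode hη hη4) Y‖₊ : ℝ≥0∞) ^ 2 = 1 := by
  unfold oneFun
  rw [lintegral_funUnique_comp (fun x => (‖plateauMode hη hη4 x‖₊ : ℝ≥0∞) ^ 2)]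
  exact lintegral_plateauMode_sq hη hη4

/-- **The flat overlap of the plateau mode is almost full**: `|∫ u|² = |⟨φ₁, u⟩|² ≥ (1 − 4η)⁶`
(`∫ g ≥ |inner cube| = (1 − 4η)³` and `‖g‖⁻² ≥ 1`; `φ₁ = 1_{Λ₁}` the unit flat mode, off which `u`
vanishes). [folklore] -/
theorem integral_plateauMode_sq_ge :
    ENNReal.ofReal ((1 - 4 * η) ^ 6) ≤
      (‖∫ x, plateauMode hη hη4 x‖₊ : ℝ≥0∞) ^ 2 := by
  have h14 : 0 < 1 - 4 * η := by linarith
  -- the real integral of the plateau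
  have hgi : Integrable (plateau hη hη4) volume :=
    (continuous_plateau hη hη4).integrable_of_hasCompactSupport
      (HasCompactSupport.intro (isCompact_closedBall (0 : Space) (3 * |(1 : ℝ)|)) fun x hx =>
        plateau_eq_zero hη hη4 fun hb => hx (mem_closedBall_zero_iff.2 (norm_le_of_mem_box hb)))
  set S : Set Space := {x : Space | ∀ k, x k ∈ Icc (2 * η) (1 - 2 * η)} with hS
  have hSm : MeasurableSet S := measurableSet_innerCube η
  have hSvol : volume S = ENNReal.ofReal ((1 - 4 * η) ^ 3) := by
    rw [hS, volume_innerCube, ENNReal.ofReal_pow h14.le]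
  have hlow : (1 - 4 * η) ^ 3 ≤ ∫ x, plateau hη hη4 x := by
    have h1 : ∫ x, S.indicator (fun _ => (1 : ℝ)) x = (1 - 4 * η) ^ 3 := by
      rw [integral_indicator hSm, setIntegral_const, smul_eq_mul, mul_one, measureReal_def, hSvol,
        ENNReal.toReal_ofReal (by positivity)]
    rw [← h1]
    refine integral_mono ((integrable_indicator_iff hSm).2 (integrableOn_const ?_)) hgi fun x => ?_
    · rw [hSvol]; exact ENNReal.ofReal_ne_top
    · by_cases hx : x ∈ S
      · rw [Set.indicator_of_mem hx, plateau_eq_one hη hη4 hx]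
      · rw [Set.indicator_of_notMem hx]; exact plateau_nonneg hη hη4 x
  -- the pairing
  have hpair : ∫ x, plateauMode hη hη4 x =
      (plateauConst hη hη4 : ℂ) * ((∫ x, plateau hη hη4 x : ℝ) : ℂ) := by
    unfold plateauMode
    rw [integral_const_mul, integral_complex_ofReal]
  rw [hpair, nnnorm_mul, ENNReal.coe_mul, mul_pow]
  have hc : ((‖(plateauConst hη hη4 : ℂ)‖₊ : ℝ≥0∞) ^ 2) = (plateauConst hη hη4 : ℝ≥0∞) ^ 2 := by
    congr 1; simp
  rw [hc]
  calc ENNReal.ofReal ((1 - 4 * η) ^ 6) = 1 * ENNReal.ofReal ((1 - 4 * η) ^ 6) := (one_mul _).symm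
    _ ≤ (plateauConst hη hη4 : ℝ≥0∞) ^ 2 *
          (‖(((∫ x, plateau hη hη4 x : ℝ)) : ℂ)‖₊ : ℝ≥0∞) ^ 2 := by
        gcongr
        · exact one_le_plateauConst_sq hη hη4
        · rw [← Poincare.ofReal_norm_sq, Complex.norm_real, Real.norm_of_nonneg
            ((pow_pos h14 3).le.trans hlow)]
          refine ENNReal.ofReal_le_ofReal ?_
          rw [show (1 - 4 * η) ^ 6 = ((1 - 4 * η) ^ 3) ^ 2 by ring]
          exact pow_le_pow_left₀ (pow_pos h14 3).le hlow 2

end Plateau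

end Summit.AtomisticToContinuum.BoseEinsteinCondensation.Theorems.PeriodicToDirichlet.Negative

end
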